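import Literature.NumberTheory.GaloisCohomology.PoitouTateSumTotallyComplex
import Literature.NumberTheory.GaloisCohomology.BrauerSumInvCyclicClassOdd
import Literature.NumberTheory.GaloisCohomology.CyclotomicLayerKilling
import Literature.NumberTheory.GaloisCohomology.PoitouTateOddLevelRealPlaces
import HarnessLib

/-!
# The reciprocity law `∑_v inv_v = 0` on `H²(Γ_K, μ_{p^k})` for `p` odd, over ANY number field

The (F1) chain of `pub/bsd-cn100` (`PoitouTateTotallyComplex`, `CorrectionAtPOfCharacter`,
`PoitouTateSumTotallyComplex`) proved Tate's reciprocity law for totally complex `K`.  The only uses of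
that hypothesis were (i) the killing of classes in the cyclotomic `ℤ_p`-tower, (ii) the archimedean
hypothesis of the cyclic reciprocity law, (iii) the vanishing of the archimedean members of the
canonical family.  For `p` ODD all three hold over an arbitrary number field: (i) by
`exists_resH_layerSubgroup_kummer_eq_zero` (`p ≠ 2 ∨` totally complex), (ii) by
`sum_localInvariantMap_localization_cupProduct_δ₀_eq_zero_of_odd` (squares of `K_∞ˣ` lie in the
identity component; a `2`-torsion Artin symbol in a group of odd order is trivial), (iii) by
`LocalInvariants.canonical_inl_eq_zero_of_odd`.  This file re-runs the chain under the hypothesis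
`p ≠ 2 ∨ IsTotallyComplex K`:

* `sum_localInvariantMap_localization_eq_zero_of_correction_of_odd_or_isTotallyComplex` (N6),
* `correction_of_characterSupply_of_odd_or_isTotallyComplex` (Tate's correction above `p`),
* `exists_correction_trivial_above_p_of_odd_or_isTotallyComplex`,
* `sumInvLocalizationEqZero_canonical_primePow_of_odd_or_isTotallyComplex` — **the reciprocity law
  `(LocalInvariants.canonical K (p^(m+1))).SumInvLocalizationEqZero` for every number field `K` and
  every odd prime `p`** (and every `p` when `K` is totally complex).

What remains for the full `∀ K` statement `poitouTate_sum_localTatePairing_eq_zero K` is the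
`2`-primary part at the real places (Tate's complex auxiliary cyclotomic field in the killing step)
and a primary decomposition without `IsTotallyComplex`.  Theorems only (D-0026).

## References

* J. Tate, *Global class field theory*, Ch. VII of Cassels–Fröhlich (1967), §9.6, §10, §11. [CasselsFrohlichANT1967]
* J. S. Milne, *Arithmetic Duality Theorems* (2006), Ch. I Thm. 4.10. [MilneADT2006]
-/

noncomputable section

open CategoryTheory Function Field NumberField IsDedekindDomain
open scoped NumberField

namespace Literature.NumberTheory.GaloisCohomology

open _root_.ContinuousCohomology
open Literature.NumberTheory.GaloisRepresentations
open Literature.NumberTheory.GaloisRepresentations.DiscreteGaloisModule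
open Literature.NumberTheory.GaloisRepresentations.LocalWeilDatum
open Literature.NumberTheory.EllipticCurves
open Literature.AnabelianGeometry.AbsoluteAnabelian
open Literature.AnabelianGeometry.AbsoluteAnabelian.Prop121vii

variable (K : Type) [Field K] [NumberField K] (p : ℕ) [hp : Fact p.Prime]

/-! ### §1. N6 under `p ≠ 2 ∨ K totally complex` -/

/-- A multiple `x.val · p^(e-m-1)` read in `ℤ/p^e` vanishes only if `x = 0` (`x ∈ ℤ/p^(m+1)`,
`m + 1 ≤ e`). [folklore] -/
private theorem eq_zero_of_val_mul_pow_eq_zero {m e : ℕ} (hme : m + 1 ≤ e) (x : ZMod (p ^ (m + 1)))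
    (h : ((x.val * p ^ (e - m - 1) : ℕ) : ZMod (p ^ e)) = 0) : x = 0 := by
  have hpp : p.Prime := hp.out
  rw [ZMod.natCast_eq_zero_iff] at h
  have hlt : x.val * p ^ (e - m - 1) < p ^ e := by
    calc x.val * p ^ (e - m - 1) < p ^ (m + 1) * p ^ (e - m - 1) :=
          Nat.mul_lt_mul_of_lt_of_le (ZMod.val_lt x) le_rfl (pow_pos hpp.pos _)
      _ = p ^ e := by rw [← pow_add]; congr 1; omega
  have h0 : x.val * p ^ (e - m - 1) = 0 := Nat.eq_zero_of_dvd_of_lt h hlt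
  rw [Nat.mul_eq_zero] at h0
  rcases h0 with h0 | h0
  · exact (ZMod.val_eq_zero x).mp h0
  · exact absurd h0 (pow_ne_zero _ hpp.ne_zero)

set_option maxHeartbeats 800000 in
/-- **`∑_v inv_v = 0` on `H²(Γ_K, μ_{p^{m+1}})`, finite places, for `p` odd OR `K` totally complex,
granting the correction at `p`** (Tate VII §10–§11): the proof of
`sum_localInvariantMap_localization_eq_zero_of_correction` with the killing step taken from
`exists_resH_layerSubgroup_kummer_eq_zero` (`p ≠ 2 ∨` totally complex) and the cyclic reciprocity law
from `sum_localInvariantMap_localization_cupProduct_δ₀_eq_zero_of_odd` in the odd case.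
[cite: CasselsFrohlichANT1967, Ch. VII §10–§11] [cite: MilneADT2006, Ch. I, Thm. 4.10(b)] -/
theorem sum_localInvariantMap_localization_eq_zero_of_correction_of_odd_or_isTotallyComplex
    (hk : p ≠ 2 ∨ IsTotallyComplex K) (m : ℕ)
    (hpre : ∀ (y : galoisCohomology (mu K (p ^ (m + 1))) 2) (S : Finset (HeightOneSpectrum (𝓞 K))),
      (∀ v ∉ S, localInvariantMap K (p ^ (m + 1)) v
        (galoisCohomology.localization (mu K (p ^ (m + 1))) (Sum.inr v) 2 y) = 0) →
      ∃ e : ℕ, m + 1 ≤ e ∧ ∃ (y' : galoisCohomology (mu K (p ^ e)) 2) (S' : Finset (HeightOneSpectrum (𝓞 K))),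
        S ⊆ S' ∧
        (∀ v : HeightOneSpectrum (𝓞 K), (p : 𝓞 K) ∈ v.asIdeal →
          galoisCohomology.localization (mu K (p ^ e)) (Sum.inr v) 2 y' = 0) ∧
        (∀ v ∉ S', localInvariantMap K (p ^ e) v
          (galoisCohomology.localization (mu K (p ^ e)) (Sum.inr v) 2 y') = 0) ∧
        (∀ T : Finset (HeightOneSpectrum (𝓞 K)), S' ⊆ T →
          ∑ v ∈ T, localInvariantMap K (p ^ e) v (galoisCohomology.localization (mu K (p ^ e)) (Sum.inr v) 2 y') =
            (((∑ v ∈ T, localInvariantMap K (p ^ (m + 1)) v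
              (galoisCohomology.localization (mu K (p ^ (m + 1))) (Sum.inr v) 2 y)).val * p ^ (e - m - 1) : ℕ) :
              ZMod (p ^ e))))
    (y : galoisCohomology (mu K (p ^ (m + 1))) 2) (S : Finset (HeightOneSpectrum (𝓞 K)))
    (hS : ∀ v ∉ S, localInvariantMap K (p ^ (m + 1)) v
      (galoisCohomology.localization (mu K (p ^ (m + 1))) (Sum.inr v) 2 y) = 0) :
    ∑ v ∈ S, localInvariantMap K (p ^ (m + 1)) v
      (galoisCohomology.localization (mu K (p ^ (m + 1))) (Sum.inr v) 2 y) = 0 := by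
  classical
  have hpp : p.Prime := hp.out
  haveI : CompactSpace (absoluteGaloisGroup K) := absoluteGaloisGroup_compactSpace K
  obtain ⟨e, hme, y', S', hSS', hyp, hS', hsumT⟩ := hpre y S hS
  -- it suffices to treat `y'` over `S'`
  suffices hmain : ∑ v ∈ S', localInvariantMap K (p ^ e) v
      (galoisCohomology.localization (mu K (p ^ e)) (Sum.inr v) 2 y') = 0 by
    have h1 := hsumT S' le_rfl
    rw [hmain] at h1
    have h2 := eq_zero_of_val_mul_pow_eq_zero p hme _ h1.symm
    rw [← h2]
    exact Finset.sum_subset hSS' fun v _ hv => hS v hv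
  -- the cyclotomic `ℤ_p`-extension and the killing layer
  obtain ⟨κ, hκ⟩ := ZpExtension.exists_isCyclotomic_holds K p (GaloisRep.cyclotomicCharacter_range_infinite K p)
  obtain ⟨m₀, -, hm₀⟩ := exists_resH_layerSubgroup_kummer_eq_zero K hk hκ e y'
  have hm₀' : resH (κ.layerSubgroup m₀) (units K) 2 ((cohomologyMap (kummerι K (p ^ e)) 2).hom y') = 0 := hm₀
  -- align the levels: `M ≥ m₀, e`; raise `y'` to level `p^M`
  set M : ℕ := max m₀ e with hMdef
  have heM : p ^ e ∣ p ^ M := pow_dvd_pow p (le_max_right _ _)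
  set y'' : galoisCohomology (mu K (p ^ M)) 2 := cohomologyMap (muInclHom K heM) 2 y' with hy''
  -- the Brauer class of `y''` dies on `Gal(K̄/K_M)`
  have hVle : κ.layerSubgroup M ≤ κ.layerSubgroup m₀ := κ.layerSubgroup_antitone (le_max_left _ _)
  have hkill : resH (κ.layerSubgroup M) (units K) 2 ((cohomologyMap (kummerι K (p ^ M)) 2).hom y'') = 0 := by
    have hK : (cohomologyMap (kummerι K (p ^ M)) 2).hom y'' = (cohomologyMap (kummerι K (p ^ e)) 2).hom y' := by
      rw [hy'']
      exact (map_comp_apply_of (ContinuousMonoidHom.id _) (ContinuousMonoidHom.id _) (ContinuousMonoidHom.id _)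
        (fun _ => rfl) (resIdHom (muInclHom K heM)) (resIdHom (kummerι K (p ^ M)))
        (resIdHom (kummerι K (p ^ e))) (fun _ => rfl) 2 y').symm
    rw [hK, resH_eq_resSub_resH (units K) hVle 2]
    change resSub (units K) hVle 2 (resH (κ.layerSubgroup m₀) (units K) 2 _) = 0
    rw [hm₀', map_zero]
  -- the layer character and the cyclic form of `y''`
  obtain ⟨ψ, hkerV, hkerL, -⟩ := κ.exists_cyclicCharacter_layer M
  haveI : FiniteDimensional K (κ.layer M) := κ.finiteDimensional_layer_holds M
  haveI : IsAbelianGalois K (κ.layer M) := κ.isAbelianGalois_layer M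
  haveI : NumberField (κ.layer M) := NumberField.of_module_finite K (κ.layer M)
  have hresψ : resH ψ.ker (units K) 2 ((cohomologyMap (kummerι K (p ^ M)) 2).hom y'') = 0 := by
    rw [hkerV]; exact hkill
  obtain ⟨b, hb⟩ := exists_eq_cupProduct_δ₀_of_resH_eq_zero ψ (κ.layer M) hkerL y'' hresψ
  -- the class `κ(b) ∪ ψ` vanishes wherever `ψ` is ramified (⊆ the places above `p`)
  have hram : ∀ v : HeightOneSpectrum (𝓞 K),
      (∃ σ ∈ absInertia (v.adicCompletion K), ψ (absGaloisRestrict K (v.adicCompletion K) σ) ≠ 0) →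
      galoisCohomology.localization (mu K (p ^ M)) (Sum.inr v) 2 (((mu K (p ^ M)).tateDualPairing (p ^ M)).cupProduct
        ((isSES_kummer K (p ^ M) (NeZero.pos _)).δ₀ (baseUnitsInvariant K (b : K) b.ne_zero))
        (oneCocycleClass _ (scalarCocycle ψ))) = 0 := by
    rintro v ⟨σ, hσ, hne⟩
    have hpv : (p : 𝓞 K) ∈ v.asIdeal := by
      by_contra hpv
      exact hne (hκ.apply_absGaloisRestrict_eq_zero_of_mem_absInertia hkerV hpv hσ)
    rw [← hb, hy'', localization_muInclHom_eq_zero_iff heM v y']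
    exact hyp v hpv
  have hSψ : ∀ v ∉ S', localInvariantMap K (p ^ M) v (galoisCohomology.localization (mu K (p ^ M)) (Sum.inr v) 2
      (((mu K (p ^ M)).tateDualPairing (p ^ M)).cupProduct
        ((isSES_kummer K (p ^ M) (NeZero.pos _)).δ₀ (baseUnitsInvariant K (b : K) b.ne_zero))
        (oneCocycleClass _ (scalarCocycle ψ)))) = 0 := fun v hv => by
    rw [← hb, hy'', localInvariantMap_localization_muInclHom_eq_zero_iff heM v y']
    exact hS' v hv
  -- the cyclic reciprocity law, read back at level `p^e`
  have hsum := hk.elim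
    (fun hp2 => sum_localInvariantMap_localization_cupProduct_δ₀_eq_zero_of_odd (κ.layer M)
      ((hpp.odd_of_ne_two hp2).pow) ψ hkerL b hram S' hSψ)
    (fun hK => by
      haveI := hK
      exact sum_localInvariantMap_localization_cupProduct_δ₀_eq_zero_of_isTotallyComplex
        (κ.layer M) ψ hkerL b hram S' hSψ)
  rw [← hb, hy'', sum_localInvariantMap_localization_muInclHom_eq_zero_iff heM] at hsum
  exact hsum


/-! ### §2. Tate's correction above `p` under `p ≠ 2 ∨ K totally complex` -/

omit [NumberField K] in
/-- The level-raising map `r ↦ r · p^(e-m-1) : ℤ/p^(m+1) → ℤ/p^e` (read on representatives) is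
additive over finite sums. [folklore] -/
private theorem sum_val_mul_pow_cast {ι : Type*} {m e : ℕ} (hme : m + 1 ≤ e) (T : Finset ι)
    (r : ι → ZMod (p ^ (m + 1))) :
    ∑ i ∈ T, (((r i).val * p ^ (e - m - 1) : ℕ) : ZMod (p ^ e)) =
      (((∑ i ∈ T, r i).val * p ^ (e - m - 1) : ℕ) : ZMod (p ^ e)) := by
  classical
  have hpe : p ^ (m + 1) * p ^ (e - m - 1) = p ^ e := by rw [← pow_add]; congr 1; omega
  -- the map is additive
  have hadd : ∀ a b : ZMod (p ^ (m + 1)), (((a + b).val * p ^ (e - m - 1) : ℕ) : ZMod (p ^ e)) =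
      ((a.val * p ^ (e - m - 1) : ℕ) : ZMod (p ^ e)) + ((b.val * p ^ (e - m - 1) : ℕ) : ZMod (p ^ e)) := by
    intro a b
    rw [← Nat.cast_add, ← add_mul, ZMod.val_add]
    have hdiv := Nat.mod_add_div (a.val + b.val) (p ^ (m + 1))
    conv_rhs => rw [← hdiv]
    rw [add_mul, Nat.cast_add, mul_assoc, mul_comm (_ / _), ← mul_assoc, hpe, Nat.cast_mul (p ^ e),
      ZMod.natCast_self, zero_mul, add_zero]
  let φ : ZMod (p ^ (m + 1)) →+ ZMod (p ^ e) :=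
    { toFun := fun a => ((a.val * p ^ (e - m - 1) : ℕ) : ZMod (p ^ e))
      map_zero' := by rw [ZMod.val_zero, zero_mul, Nat.cast_zero]
      map_add' := hadd }
  exact (map_sum φ r T).symm

/-- **Tate's correction at `p` from a supplied auxiliary character, for `p` odd OR `K` totally
complex** (Cassels–Fröhlich VII §11): the statement of `correction_of_characterSupply` with the
instance `[IsTotallyComplex K]` replaced by the hypothesis `p ≠ 2 ∨ IsTotallyComplex K`; same proof,
the cyclic reciprocity law being `sum_localInvariantMap_localization_cupProduct_δ₀_eq_zero_of_odd`
(any `K`, odd level) in the first case. [cite: CasselsFrohlichANT1967, Ch. VII §11] -/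
theorem correction_of_characterSupply_of_odd_or_isTotallyComplex (hpk : p ≠ 2 ∨ IsTotallyComplex K) (m : ℕ)
    (hsup : ∀ S : Finset (HeightOneSpectrum (𝓞 K)), ∃ e : ℕ, m + 1 ≤ e ∧
      ∃ (ψ : CyclicCharacter (absoluteGaloisGroup K) (p ^ e)) (L : IntermediateField K (AlgebraicClosure K))
        (_ : FiniteDimensional K L) (_ : IsAbelianGalois K L) (Q : Finset (HeightOneSpectrum (𝓞 K))),
        ψ.ker = galFixing K L ∧ (∀ w ∈ Q, w ∉ S ∧ (p : 𝓞 K) ∉ w.asIdeal) ∧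
        (∀ v : HeightOneSpectrum (𝓞 K), v ∉ Q → ∀ σ ∈ absInertia (v.adicCompletion K),
          ψ (absGaloisRestrict K (v.adicCompletion K) σ) = 0) ∧
        (∀ v : HeightOneSpectrum (𝓞 K), (p : 𝓞 K) ∈ v.asIdeal →
          ∀ φ : absoluteGaloisGroup (v.adicCompletion K), IsFrobPow φ 1 →
            Nat.gcd (ψ (absGaloisRestrict K (v.adicCompletion K) φ)).val (p ^ e) ∣ p ^ (e - m - 1)))
    (y : galoisCohomology (mu K (p ^ (m + 1))) 2) (S : Finset (HeightOneSpectrum (𝓞 K)))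
    (hS : ∀ v ∉ S, localInvariantMap K (p ^ (m + 1)) v
      (galoisCohomology.localization (mu K (p ^ (m + 1))) (Sum.inr v) 2 y) = 0) :
    ∃ e : ℕ, m + 1 ≤ e ∧ ∃ (y' : galoisCohomology (mu K (p ^ e)) 2) (S' : Finset (HeightOneSpectrum (𝓞 K))),
      S ⊆ S' ∧
      (∀ v : HeightOneSpectrum (𝓞 K), (p : 𝓞 K) ∈ v.asIdeal →
        galoisCohomology.localization (mu K (p ^ e)) (Sum.inr v) 2 y' = 0) ∧
      (∀ v ∉ S', localInvariantMap K (p ^ e) v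
        (galoisCohomology.localization (mu K (p ^ e)) (Sum.inr v) 2 y') = 0) ∧
      (∀ T : Finset (HeightOneSpectrum (𝓞 K)), S' ⊆ T →
        ∑ v ∈ T, localInvariantMap K (p ^ e) v (galoisCohomology.localization (mu K (p ^ e)) (Sum.inr v) 2 y') =
          (((∑ v ∈ T, localInvariantMap K (p ^ (m + 1)) v
            (galoisCohomology.localization (mu K (p ^ (m + 1))) (Sum.inr v) 2 y)).val * p ^ (e - m - 1) : ℕ) :
            ZMod (p ^ e))) := by
  classical
  have hpp : p.Prime := hp.out
  haveI : CompactSpace (absoluteGaloisGroup K) := absoluteGaloisGroup_compactSpace K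
  obtain ⟨e, hme, ψ, L, hLfin, hLab, Q, hker, hQ, hunr, hfrob⟩ := hsup S
  haveI := hLfin
  haveI := hLab
  haveI : NumberField L := NumberField.of_module_finite K L
  have hdvd : p ^ (m + 1) ∣ p ^ e := pow_dvd_pow p hme
  have hpe : p ^ (m + 1) * p ^ (e - m - 1) = p ^ e := by rw [← pow_add]; congr 1; omega
  have hediv : p ^ e / p ^ (m + 1) = p ^ (e - m - 1) := by
    rw [Nat.pow_div hme hpp.pos]; congr 1
  have hn1 : 1 < p ^ e := Nat.one_lt_pow (by omega) hpp.one_lt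
  set ye : galoisCohomology (mu K (p ^ e)) 2 := cohomologyMap (muInclHom K hdvd) 2 y with hye
  -- notation: invariants and localisations at level `p^e`
  let loc := fun (v : HeightOneSpectrum (𝓞 K)) (z : galoisCohomology (mu K (p ^ e)) 2) =>
    galoisCohomology.localization (mu K (p ^ e)) (Sum.inr v) 2 z
  let inv := fun (v : HeightOneSpectrum (𝓞 K)) (z : galoisCohomology (mu K (p ^ e)) 2) =>
    localInvariantMap K (p ^ e) v (loc v z)
  let r := fun (v : HeightOneSpectrum (𝓞 K)) =>
    localInvariantMap K (p ^ (m + 1)) v (galoisCohomology.localization (mu K (p ^ (m + 1))) (Sum.inr v) 2 y)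
  have hinv_ye : ∀ v, inv v ye = (((r v).val * p ^ (e - m - 1) : ℕ) : ZMod (p ^ e)) := fun v => by
    have h := localInvariantMap_localization_cohomologyMap_muInclHom (K := K) hdvd v y
    rw [hediv] at h
    exact h
  -- the places above `p`
  have hp0 : ((p : 𝓞 K) : K) ≠ 0 := by exact_mod_cast hpp.ne_zero
  set P : Finset (HeightOneSpectrum (𝓞 K)) :=
    (finite_setOf_valued_ne_one (Units.mk0 ((p : 𝓞 K) : K) hp0)).toFinset with hPdef
  have hPmem : ∀ v : HeightOneSpectrum (𝓞 K), v ∈ P ↔ (p : 𝓞 K) ∈ v.asIdeal := by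
    intro v
    rw [hPdef, Set.Finite.mem_toFinset, Set.mem_setOf_eq, Units.val_mk0, valued_algebraMap_adicCompletion,
      ← HeightOneSpectrum.valuation_lt_one_iff_mem (K := K), lt_iff_le_and_ne]
    exact ⟨fun h => ⟨HeightOneSpectrum.valuation_le_one v _, h⟩, fun h => h.2⟩
  have hPQ : Disjoint P Q := by
    rw [Finset.disjoint_left]
    intro v hvP hvQ
    exact (hQ v hvQ).2 ((hPmem v).mp hvP)
  -- the unramified evaluation at every `v ∉ Q`
  have hloc : ∀ v : HeightOneSpectrum (𝓞 K), v ∉ Q → ∃ f : ℕ,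
      (∀ (x : K) (hx : x ≠ 0), inv v (((mu K (p ^ e)).tateDualPairing (p ^ e)).cupProduct
          ((isSES_kummer K (p ^ e) (NeZero.pos _)).δ₀ (baseUnitsInvariant K x hx))
          (oneCocycleClass _ (scalarCocycle ψ))) =
        (f : ZMod (p ^ e)) * (ord (v.adicCompletion K) (algebraMap K (v.adicCompletion K) x) : ZMod (p ^ e))) ∧
      ∀ φ : absoluteGaloisGroup (v.adicCompletion K), IsFrobPow φ 1 →
        ψ (absGaloisRestrict K (v.adicCompletion K) φ) = (f : ZMod (p ^ e)) := by
    intro v hvQ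
    haveI : CharZero (v.adicCompletion K) := charZero_adicCompletion v
    obtain ⟨ψE, hIE, hFE, -, -⟩ := exists_normalizedCharacter (v.adicCompletion K) (p ^ e) hn1
    obtain ⟨f, hψf, hf⟩ := exists_apply_absGaloisRestrict_eq_mul (v.adicCompletion K) ψ (hunr v hvQ) ψE hIE hFE
    exact ⟨f, fun x hx => localInvariantMap_localization_cupProduct_δ₀ v ψ ψE hIE hFE hψf x hx, hf⟩
  choose! f hf hfφ using hloc
  -- the multipliers `k_v` at the places above `p`
  have hk : ∀ v : HeightOneSpectrum (𝓞 K), v ∈ P → ∃ k : ℕ, (k : ZMod (p ^ e)) * (f v : ZMod (p ^ e)) = inv v ye := by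
    intro v hv
    have hvp : (p : 𝓞 K) ∈ v.asIdeal := (hPmem v).mp hv
    have hvQ : v ∉ Q := fun h => (hQ v h).2 hvp
    obtain ⟨φ, hφ⟩ := exists_isAbsArithFrob_holds (v.adicCompletion K)
    have hφ1 : IsFrobPow φ 1 := IsAbsArithFrob.isFrobPow_holds hφ
    have hg := hfrob v hvp φ hφ1
    rw [hfφ v hvQ φ hφ1] at hg
    refine ZMod.exists_natCast_mul_eq_of_gcd_dvd _ _ (hg.trans ?_)
    rw [hinv_ye v, ZMod.val_natCast, Nat.mod_eq_of_lt]
    · exact Dvd.intro_left _ rfl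
    · calc (r v).val * p ^ (e - m - 1) < p ^ (m + 1) * p ^ (e - m - 1) :=
          Nat.mul_lt_mul_of_lt_of_le (ZMod.val_lt _) le_rfl (pow_pos hpp.pos _)
        _ = p ^ e := hpe
  choose! k hk using hk
  -- the auxiliary element `a`
  obtain ⟨a, ha0, haP, haQ⟩ := exists_ord_eq_and_valuation_sub_one_lt P Q hPQ k
  set γ : galoisCohomology (mu K (p ^ e)) 2 := ((mu K (p ^ e)).tateDualPairing (p ^ e)).cupProduct
      ((isSES_kummer K (p ^ e) (NeZero.pos _)).δ₀ (baseUnitsInvariant K a ha0))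
      (oneCocycleClass _ (scalarCocycle ψ)) with hγ
  -- (γ1) `γ` matches `y_e` above `p`
  have hγP : ∀ v ∈ P, loc v ye = loc v γ := by
    intro v hv
    have hvQ : v ∉ Q := fun h => (hQ v h).2 ((hPmem v).mp hv)
    apply (localInvariantMap_bijective (K := K) (n := p ^ e) v).1
    change inv v ye = inv v γ
    rw [hγ, hf v hvQ a ha0, haP v hv, ← hk v hv, Int.cast_natCast, mul_comm]
  -- (γ2) `γ` vanishes above `q`
  have hγQ : ∀ w ∈ Q, loc w γ = 0 := by
    intro w hw
    have hpw : ((p ^ e : ℕ) : 𝓞 K) ∉ w.asIdeal := by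
      rw [Nat.cast_pow]
      exact fun h => (hQ w hw).2 (w.isPrime.mem_of_pow_mem _ h)
    exact localization_cupProduct_δ₀_eq_zero_of_valuation_sub_one_lt w hpw a ha0 (haQ w hw) _
  -- (γ3) the support of `γ`
  set Sa : Finset (HeightOneSpectrum (𝓞 K)) := (finite_setOf_valued_ne_one (Units.mk0 a ha0)).toFinset with hSa
  have hγ0 : ∀ v ∉ Q ∪ Sa, inv v γ = 0 := by
    intro v hv
    rw [Finset.notMem_union] at hv
    have hval : Valued.v (algebraMap K (v.adicCompletion K) a) = 1 := by
      by_contra h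
      exact hv.2 ((finite_setOf_valued_ne_one (Units.mk0 a ha0)).mem_toFinset.mpr h)
    have hord : ord (v.adicCompletion K) (algebraMap K (v.adicCompletion K) a) = 0 :=
      ord_adicCompletion_eq_of_valued_eq v ((map_ne_zero_iff _ (algebraMap K _).injective).2 ha0)
        (e := 0) (by rw [hval, neg_zero, WithZero.exp_zero])
    change inv v γ = 0
    rw [hγ, hf v hv.1 a ha0, hord, Int.cast_zero, mul_zero]
  -- (γ4) the cyclic reciprocity law for `γ`
  have hram : ∀ v : HeightOneSpectrum (𝓞 K),
      (∃ σ ∈ absInertia (v.adicCompletion K), ψ (absGaloisRestrict K (v.adicCompletion K) σ) ≠ 0) → loc v γ = 0 := by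
    rintro v ⟨σ, hσ, hne⟩
    have hvQ : v ∈ Q := by
      by_contra h
      exact hne (hunr v h σ hσ)
    exact hγQ v hvQ
  have hγsum : ∀ T : Finset (HeightOneSpectrum (𝓞 K)), Q ∪ Sa ⊆ T → ∑ v ∈ T, inv v γ = 0 := by
    intro T hT
    have h0 := hpk.elim
      (fun hp2 => sum_localInvariantMap_localization_cupProduct_δ₀_eq_zero_of_odd L
        ((hpp.odd_of_ne_two hp2).pow) ψ hker (Units.mk0 a ha0) hram (Q ∪ Sa) hγ0)
      (fun hK => by
        haveI := hK
        exact sum_localInvariantMap_localization_cupProduct_δ₀_eq_zero_of_isTotallyComplex L ψ hker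
          (Units.mk0 a ha0) hram (Q ∪ Sa) hγ0)
    rw [← Finset.sum_subset hT (fun v _ hv => hγ0 v hv)]
    exact h0
  -- outputs
  refine ⟨e, hme, ye - γ, S ∪ P ∪ (Q ∪ Sa), Finset.subset_union_left.trans Finset.subset_union_left,
    fun v hv => ?_, fun v hv => ?_, fun T hT => ?_⟩
  · -- vanishing above `p`
    rw [map_sub]
    change loc v ye - loc v γ = 0
    rw [hγP v ((hPmem v).mpr hv), sub_self]
  · -- support
    rw [Finset.notMem_union, Finset.notMem_union] at hv
    change inv v (ye - γ) = 0
    have h1 : inv v ye = 0 := by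
      rw [hinv_ye v, show r v = 0 from hS v hv.1.1, ZMod.val_zero, zero_mul, Nat.cast_zero]
    change localInvariantMap K (p ^ e) v (galoisCohomology.localization (mu K (p ^ e)) (Sum.inr v) 2 (ye - γ)) = 0
    rw [map_sub, map_sub]
    change inv v ye - inv v γ = 0
    rw [h1, hγ0 v hv.2, sub_zero]
  · -- the sum identity
    have hT' : Q ∪ Sa ⊆ T := Finset.subset_union_right.trans hT
    calc ∑ v ∈ T, localInvariantMap K (p ^ e) v (loc v (ye - γ))
        = ∑ v ∈ T, (inv v ye - inv v γ) := Finset.sum_congr rfl fun v _ => by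
          change localInvariantMap K (p ^ e) v
            (galoisCohomology.localization (mu K (p ^ e)) (Sum.inr v) 2 (ye - γ)) = _
          rw [map_sub, map_sub]
      _ = ∑ v ∈ T, inv v ye - ∑ v ∈ T, inv v γ := Finset.sum_sub_distrib _ _
      _ = ∑ v ∈ T, inv v ye := by rw [hγsum T hT', sub_zero]
      _ = ∑ v ∈ T, (((r v).val * p ^ (e - m - 1) : ℕ) : ZMod (p ^ e)) := Finset.sum_congr rfl fun v _ => hinv_ye v
      _ = _ := sum_val_mul_pow_cast p hme T r


/-! ### §3. The reciprocity law at odd prime-power levels, any number field -/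

/-- **Tate's correction above `p`, for `p` odd or `K` totally complex** — the hypothesis `hpre` of the
N6 assembly, discharged by `correction_of_characterSupply_of_odd_or_isTotallyComplex` fed with the
character supply `exists_cyclicCharacter_correctionSupply`. [cite: CasselsFrohlichANT1967, Ch. VII §11] -/
theorem exists_correction_trivial_above_p_of_odd_or_isTotallyComplex (hk : p ≠ 2 ∨ IsTotallyComplex K)
    (m : ℕ) (y : galoisCohomology (mu K (p ^ (m + 1))) 2) (S : Finset (HeightOneSpectrum (𝓞 K)))
    (hS : ∀ v ∉ S, localInvariantMap K (p ^ (m + 1)) v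
      (galoisCohomology.localization (mu K (p ^ (m + 1))) (Sum.inr v) 2 y) = 0) :
    ∃ e : ℕ, m + 1 ≤ e ∧ ∃ (y' : galoisCohomology (mu K (p ^ e)) 2) (S' : Finset (HeightOneSpectrum (𝓞 K))),
      S ⊆ S' ∧
      (∀ v : HeightOneSpectrum (𝓞 K), (p : 𝓞 K) ∈ v.asIdeal →
        galoisCohomology.localization (mu K (p ^ e)) (Sum.inr v) 2 y' = 0) ∧
      (∀ v ∉ S', localInvariantMap K (p ^ e) v
        (galoisCohomology.localization (mu K (p ^ e)) (Sum.inr v) 2 y') = 0) ∧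
      (∀ T : Finset (HeightOneSpectrum (𝓞 K)), S' ⊆ T →
        ∑ v ∈ T, localInvariantMap K (p ^ e) v (galoisCohomology.localization (mu K (p ^ e)) (Sum.inr v) 2 y') =
          (((∑ v ∈ T, localInvariantMap K (p ^ (m + 1)) v
            (galoisCohomology.localization (mu K (p ^ (m + 1))) (Sum.inr v) 2 y)).val * p ^ (e - m - 1) : ℕ) :
            ZMod (p ^ e))) :=
  correction_of_characterSupply_of_odd_or_isTotallyComplex K p hk m
    (exists_cyclicCharacter_correctionSupply p m) y S hS

/-- **`∑_{v ∈ S} inv_v(loc_v y) = 0` for every `y ∈ H²(Γ_K, μ_{p^{m+1}})` with invariants supported in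
`S`, `p` odd or `K` totally complex** (finite places). [cite: CasselsFrohlichANT1967, Ch. VII §11] -/
theorem sum_localInvariantMap_localization_eq_zero_of_odd_or_isTotallyComplex
    (hk : p ≠ 2 ∨ IsTotallyComplex K) (m : ℕ)
    (y : galoisCohomology (mu K (p ^ (m + 1))) 2) (S : Finset (HeightOneSpectrum (𝓞 K)))
    (hS : ∀ v ∉ S, localInvariantMap K (p ^ (m + 1)) v
      (galoisCohomology.localization (mu K (p ^ (m + 1))) (Sum.inr v) 2 y) = 0) :
    ∑ v ∈ S, localInvariantMap K (p ^ (m + 1)) v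
      (galoisCohomology.localization (mu K (p ^ (m + 1))) (Sum.inr v) 2 y) = 0 :=
  sum_localInvariantMap_localization_eq_zero_of_correction_of_odd_or_isTotallyComplex K p hk m
    (exists_correction_trivial_above_p_of_odd_or_isTotallyComplex K p hk m) y S hS

/-- **The reciprocity law `∑_v inv_v = 0` on `H²(Γ_K, μ_{p^{m+1}})` for every number field `K` and
every ODD prime `p`, and for every prime when `K` is totally complex** (Tate, Cassels–Fröhlich VII
§9.6/§11; Milne ADT I 4.10), for the canonical family of local invariant maps: the archimedean members
vanish (`LocalInvariants.canonical_inl_eq_zero_of_odd`, resp. `…_of_isComplex`) and the finite sum is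
`sum_localInvariantMap_localization_eq_zero_of_odd_or_isTotallyComplex`.
[cite: CasselsFrohlichANT1967, Ch. VII §11] -/
theorem sumInvLocalizationEqZero_canonical_primePow_of_odd_or_isTotallyComplex
    (hk : p ≠ 2 ∨ IsTotallyComplex K) (m : ℕ) :
    (LocalInvariants.canonical K (p ^ (m + 1))).SumInvLocalizationEqZero := by
  rcases hk with hp2 | hK
  · exact LocalInvariants.sumInvLocalizationEqZero_canonical_of_odd_of_finite
      ((hp.out.odd_of_ne_two hp2).pow) fun c S hS =>
        sum_localInvariantMap_localization_eq_zero_of_odd_or_isTotallyComplex K p (Or.inl hp2) m c S hS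
  · haveI := hK
    exact sumInvLocalizationEqZero_canonical_primePow_of_correction K p m
      (exists_correction_trivial_above_p K p m)

end Literature.NumberTheory.GaloisCohomology

end
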